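import Mathlib
import Summits.Ventures.PercRepro2.CoinChainXA
import Summits.Ventures.PercRepro2.CoinChainGenQprime
import Summits.Ventures.PercRepro2.CoinChainReductionGen
import Summits.Ventures.PercRepro2.CoinChainHeadHyps

/-!
# The GENERAL AND-switch chain from (XA) alone, and row 2′DARC at the general chain from (XA)
(blind cell PercRepro2, night-2 g25; proofs/NIGHT2-DARC.md §65)

* `chain_functional_nonneg_of_XA` — the general chain (`a` entered from `ent ⊆ U` surely and
  from `a'` by the coin, `a'` entered from `ent'`) holds at EVERY `ρ ∈ [0, 1]` for every pair of
  nonnegative increasing markers under the head hypotheses, `d' ≤ d`, positive world masses, a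
  positive ideal mass, and the ONE coin-free inequality (XA)
  `a0²·U110 + a0 b0·U001 − e0·Δ ≥ 0`: (Q′) is discharged by `chain_Qprime` and the Bernstein
  assembly is `chain_functional_nonneg_of_XA_Qprime`.
* `darc_of_chain_of_XA` — row 2′DARC at the general chain on the chain data (`ν = P(level)`,
  `c = chainC`, `d = chainD`, `d' = chainD'`, point markers), under (XA) on those data
  (`chain_darc_of_functional`, `chainPhi_head_hyps`, `OrTailU.head_props` as in
  `darc_of_chain_of_bernstein`).  (XA) is census-true (0 / 16,800) and is the row's open content.
-/

namespace Summit.Ventures.PercRepro2.Coin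

open Classical

section XAOnly

variable {V : Type*} [DecidableEq V] {R : Type*} [Field R] [LinearOrder R] [IsStrictOrderedRing R]

/-- **THE GENERAL AND-SWITCH CHAIN AT EVERY COIN PROBABILITY FROM (XA) ALONE** — (Q′) is a
theorem (`chain_Qprime`).  Hypotheses: those of `chain_Qprime` and `hXA`. -/
theorem chain_functional_nonneg_of_XA (U ent ent' : Finset V) (ν c d d' : Finset V → R)
    (ρ : R) (hρ0 : 0 ≤ ρ) (hρ1 : ρ ≤ 1) (hν0 : ∀ W, 0 ≤ ν W)
    (hν : ∀ s ⊆ U, ∀ t ⊆ U, ν s * ν t ≤ ν (s ∩ t) * ν (s ∪ t))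
    (hc0 : ∀ W, 0 ≤ c W) (hd0 : ∀ W, 0 ≤ d W) (hd'0 : ∀ W, 0 ≤ d' W)
    (hdc : ∀ W, d W ≤ c W) (hd'c : ∀ W, d' W ≤ c W) (hd'd : ∀ W, d' W ≤ d W)
    (hcc : ∀ s t, c s * c t ≤ c (s ∩ t) * c (s ∪ t))
    (hdd : ∀ s t, d s * d t ≤ d (s ∩ t) * d (s ∪ t))
    (hd'd' : ∀ s t, d' s * d' t ≤ d' (s ∩ t) * d' (s ∪ t))
    (hcd : ∀ s t, c s * d t ≤ c (s ∩ t) * d (s ∪ t))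
    (hcd' : ∀ s t, c s * d' t ≤ c (s ∩ t) * d' (s ∪ t))
    (hdd' : ∀ s t, d s * d' t ≤ d (s ∩ t) * d' (s ∪ t))
    (hratio : ∀ s t, s ⊆ t → d s * c t ≤ c s * d t)
    (hratio' : ∀ s t, s ⊆ t → d' s * c t ≤ c s * d' t)
    (x y : Finset V → R) (hx0 : ∀ W, 0 ≤ x W) (hy0 : ∀ W, 0 ≤ y W)
    (hxm : ∀ s t, x s ≤ x (s ∪ t)) (hym : ∀ s t, y s ≤ y (s ∪ t))
    (hpos0 : 0 < ∑ W ∈ U.powerset, ν W * chainMix ent ent' 0 c d W)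
    (hpos1 : 0 < ∑ W ∈ U.powerset, ν W * chainMix ent ent' 1 c d W)
    (hmI : 0 < ∑ W ∈ U.powerset.filter (fun W => ¬ ∃ r ∈ ent ∪ ent', r ∈ W), ν W * c W)
    (hXA : 0 ≤ (∑ W ∈ U.powerset, ν W * chainMix ent ent' 0 c d W) ^ 2 *
          ((∑ W ∈ U.powerset, ν W * chainMix ent ent' 1 c d W) *
            (∑ W ∈ U.powerset, ν W * chainMix ent ent' 1 c d W) *
            (∑ W ∈ U.powerset, ν W * chainMix ent ent' 0 c d' W * (x W * y W))
          - (∑ W ∈ U.powerset, ν W * chainMix ent ent' 1 c d W) *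
            (∑ W ∈ U.powerset, ν W * chainMix ent ent' 1 c d W * y W) *
            (∑ W ∈ U.powerset, ν W * chainMix ent ent' 0 c d' W * x W)
          - (∑ W ∈ U.powerset, ν W * chainMix ent ent' 1 c d W) *
            (∑ W ∈ U.powerset, ν W * chainMix ent ent' 1 c d W * x W) *
            (∑ W ∈ U.powerset, ν W * chainMix ent ent' 0 c d' W * y W)
          + (∑ W ∈ U.powerset, ν W * chainMix ent ent' 1 c d W * x W) *
            (∑ W ∈ U.powerset, ν W * chainMix ent ent' 1 c d W * y W) *
            (∑ W ∈ U.powerset, ν W * chainMix ent ent' 0 c d' W))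
        + (∑ W ∈ U.powerset, ν W * chainMix ent ent' 0 c d W) *
          (∑ W ∈ U.powerset, ν W * chainMix ent ent' 1 c d W) *
          ((∑ W ∈ U.powerset, ν W * chainMix ent ent' 0 c d W) *
            (∑ W ∈ U.powerset, ν W * chainMix ent ent' 0 c d W) *
            (∑ W ∈ U.powerset, ν W * chainMix ent ent' 1 c d' W * (x W * y W))
          - (∑ W ∈ U.powerset, ν W * chainMix ent ent' 0 c d W) *
            (∑ W ∈ U.powerset, ν W * chainMix ent ent' 0 c d W * y W) *
            (∑ W ∈ U.powerset, ν W * chainMix ent ent' 1 c d' W * x W)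
          - (∑ W ∈ U.powerset, ν W * chainMix ent ent' 0 c d W) *
            (∑ W ∈ U.powerset, ν W * chainMix ent ent' 0 c d W * x W) *
            (∑ W ∈ U.powerset, ν W * chainMix ent ent' 1 c d' W * y W)
          + (∑ W ∈ U.powerset, ν W * chainMix ent ent' 0 c d W * x W) *
            (∑ W ∈ U.powerset, ν W * chainMix ent ent' 0 c d W * y W) *
            (∑ W ∈ U.powerset, ν W * chainMix ent ent' 1 c d' W))
        - (∑ W ∈ U.powerset, ν W * chainMix ent ent' 0 c d' W) *
          (((∑ W ∈ U.powerset, ν W * chainMix ent ent' 1 c d W) *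
              (∑ W ∈ U.powerset, ν W * chainMix ent ent' 0 c d W * x W)
            - (∑ W ∈ U.powerset, ν W * chainMix ent ent' 0 c d W) *
              (∑ W ∈ U.powerset, ν W * chainMix ent ent' 1 c d W * x W)) *
           ((∑ W ∈ U.powerset, ν W * chainMix ent ent' 1 c d W) *
              (∑ W ∈ U.powerset, ν W * chainMix ent ent' 0 c d W * y W)
            - (∑ W ∈ U.powerset, ν W * chainMix ent ent' 0 c d W) *
              (∑ W ∈ U.powerset, ν W * chainMix ent ent' 1 c d W * y W)))) :
    0 ≤ (∑ W ∈ U.powerset, ν W * chainMix ent ent' ρ c d W) ^ 2 *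
          (∑ W ∈ U.powerset, ν W * chainMix ent ent' ρ c d' W * (x W * y W))
        - (∑ W ∈ U.powerset, ν W * chainMix ent ent' ρ c d W) *
          (∑ W ∈ U.powerset, ν W * chainMix ent ent' ρ c d W * x W) *
          (∑ W ∈ U.powerset, ν W * chainMix ent ent' ρ c d' W * y W)
        - (∑ W ∈ U.powerset, ν W * chainMix ent ent' ρ c d W) *
          (∑ W ∈ U.powerset, ν W * chainMix ent ent' ρ c d W * y W) *
          (∑ W ∈ U.powerset, ν W * chainMix ent ent' ρ c d' W * x W)
        + (∑ W ∈ U.powerset, ν W * chainMix ent ent' ρ c d W * x W) *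
          (∑ W ∈ U.powerset, ν W * chainMix ent ent' ρ c d W * y W) *
          (∑ W ∈ U.powerset, ν W * chainMix ent ent' ρ c d' W) := by
  exact chain_functional_nonneg_of_XA_Qprime U ent ent' ν c d d' ρ hρ0 hρ1 hν0 hν hc0 hd0 hd'0 hdc
    hd'c hd'd hcc hdd hd'd' hcd hcd' hdd' hratio hratio' x y hx0 hy0 hxm hym hpos0 hpos1 hXA
    (chain_Qprime U ent ent' ν c d d' hν0 hν hc0 hd0 hd'0 hdc hd'c hd'd hcc hdd hd'd' hcd hcd' hdd'
      hratio hratio' x y hx0 hy0 hxm hym hpos0 hpos1 hmI)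

end XAOnly

section XADarc

variable {V : Type*} {E : Type*} [Fintype V] [DecidableEq V] [Fintype E] [DecidableEq E]
  {R : Type*} [Field R] [LinearOrder R] [IsStrictOrderedRing R]
  {arcs : E → Finset (V × V)} {s : V} {U : Finset V} {ent ent' : Finset V} {c' : V → E}
  {a' a w : V} {c : V → E}

/-- **ROW 2′DARC AT THE GENERAL AND-SWITCH CHAIN UNDER (XA)** (chain data `ν = P(level)`,
`c = chainC`, `d = chainD`, `d' = chainD'`, point markers `m₁, m₂ ∈ U`, an lsm core, positive
world masses and ideal mass, and (XA) on the chain data): `DARC pr arcs s {t} m₁ m₂ a w`. -/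
theorem darc_of_chain_of_XA (pr : E → R) (hp : IsProbVec pr) (hS : SameEnds arcs)
    (h' : OrTailK arcs s U ent' c' a') (hsure' : ∀ r ∈ ent', pr (c' r) = 1)
    (h : OrTailK arcs s (insert a' U) (insert a' ent) c a) (hsure : ∀ r ∈ ent, pr (c r) = 1)
    (hentU : ent ⊆ U)
    {m₁ m₂ : V} (hm₁ : m₁ ∈ U) (hm₂ : m₂ ∈ U)
    (hν : ∀ W W', W ⊆ U → W' ⊆ U →
      prob pr (coreLevel arcs s U W) * prob pr (coreLevel arcs s U W') ≤
        prob pr (coreLevel arcs s U (W ∩ W')) * prob pr (coreLevel arcs s U (W ∪ W')))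
    {t : V} (htC : t ∉ insert a (insert a' U)) (hts : t ≠ s) (hws : w ≠ s)
    (hwC : w ∉ insert a (insert a' U))
    (hpos0 : 0 < ∑ W ∈ U.powerset, prob pr (coreLevel arcs s U W) *
      chainMix ent ent' 0 (chainC pr arcs s t U ent' a' a) (chainD pr arcs s t U ent' a' a) W)
    (hpos1 : 0 < ∑ W ∈ U.powerset, prob pr (coreLevel arcs s U W) *
      chainMix ent ent' 1 (chainC pr arcs s t U ent' a' a) (chainD pr arcs s t U ent' a' a) W)
    (hmI : 0 < ∑ W ∈ U.powerset.filter (fun W => ¬ ∃ r ∈ ent ∪ ent', r ∈ W),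
      prob pr (coreLevel arcs s U W) * chainC pr arcs s t U ent' a' a W)
    (hXA : 0 ≤ (∑ W ∈ U.powerset, prob pr (coreLevel arcs s U W) *
            chainMix ent ent' 0 (chainC pr arcs s t U ent' a' a) (chainD pr arcs s t U ent' a' a) W) ^ 2 *
          ((∑ W ∈ U.powerset, prob pr (coreLevel arcs s U W) *
            chainMix ent ent' 1 (chainC pr arcs s t U ent' a' a) (chainD pr arcs s t U ent' a' a) W) *
            (∑ W ∈ U.powerset, prob pr (coreLevel arcs s U W) *
            chainMix ent ent' 1 (chainC pr arcs s t U ent' a' a) (chainD pr arcs s t U ent' a' a) W) *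
            (∑ W ∈ U.powerset, prob pr (coreLevel arcs s U W) *
            chainMix ent ent' 0 (chainC pr arcs s t U ent' a' a) (chainD' pr arcs s t U ent' a' a w) W * ((if m₁ ∈ W then (1 : R) else 0) * (if m₂ ∈ W then (1 : R) else 0)))
          - (∑ W ∈ U.powerset, prob pr (coreLevel arcs s U W) *
            chainMix ent ent' 1 (chainC pr arcs s t U ent' a' a) (chainD pr arcs s t U ent' a' a) W) *
            (∑ W ∈ U.powerset, prob pr (coreLevel arcs s U W) *
            chainMix ent ent' 1 (chainC pr arcs s t U ent' a' a) (chainD pr arcs s t U ent' a' a) W *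
            (if m₂ ∈ W then (1 : R) else 0)) *
            (∑ W ∈ U.powerset, prob pr (coreLevel arcs s U W) *
            chainMix ent ent' 0 (chainC pr arcs s t U ent' a' a) (chainD' pr arcs s t U ent' a' a w) W *
            (if m₁ ∈ W then (1 : R) else 0))
          - (∑ W ∈ U.powerset, prob pr (coreLevel arcs s U W) *
            chainMix ent ent' 1 (chainC pr arcs s t U ent' a' a) (chainD pr arcs s t U ent' a' a) W) *
            (∑ W ∈ U.powerset, prob pr (coreLevel arcs s U W) *
            chainMix ent ent' 1 (chainC pr arcs s t U ent' a' a) (chainD pr arcs s t U ent' a' a) W *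
            (if m₁ ∈ W then (1 : R) else 0)) *
            (∑ W ∈ U.powerset, prob pr (coreLevel arcs s U W) *
            chainMix ent ent' 0 (chainC pr arcs s t U ent' a' a) (chainD' pr arcs s t U ent' a' a w) W *
            (if m₂ ∈ W then (1 : R) else 0))
          + (∑ W ∈ U.powerset, prob pr (coreLevel arcs s U W) *
            chainMix ent ent' 1 (chainC pr arcs s t U ent' a' a) (chainD pr arcs s t U ent' a' a) W *
            (if m₁ ∈ W then (1 : R) else 0)) *
            (∑ W ∈ U.powerset, prob pr (coreLevel arcs s U W) *
            chainMix ent ent' 1 (chainC pr arcs s t U ent' a' a) (chainD pr arcs s t U ent' a' a) W *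
            (if m₂ ∈ W then (1 : R) else 0)) *
            (∑ W ∈ U.powerset, prob pr (coreLevel arcs s U W) *
            chainMix ent ent' 0 (chainC pr arcs s t U ent' a' a) (chainD' pr arcs s t U ent' a' a w) W))
        + (∑ W ∈ U.powerset, prob pr (coreLevel arcs s U W) *
            chainMix ent ent' 0 (chainC pr arcs s t U ent' a' a) (chainD pr arcs s t U ent' a' a) W) *
          (∑ W ∈ U.powerset, prob pr (coreLevel arcs s U W) *
            chainMix ent ent' 1 (chainC pr arcs s t U ent' a' a) (chainD pr arcs s t U ent' a' a) W) *
          ((∑ W ∈ U.powerset, prob pr (coreLevel arcs s U W) *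
            chainMix ent ent' 0 (chainC pr arcs s t U ent' a' a) (chainD pr arcs s t U ent' a' a) W) *
            (∑ W ∈ U.powerset, prob pr (coreLevel arcs s U W) *
            chainMix ent ent' 0 (chainC pr arcs s t U ent' a' a) (chainD pr arcs s t U ent' a' a) W) *
            (∑ W ∈ U.powerset, prob pr (coreLevel arcs s U W) *
            chainMix ent ent' 1 (chainC pr arcs s t U ent' a' a) (chainD' pr arcs s t U ent' a' a w) W * ((if m₁ ∈ W then (1 : R) else 0) * (if m₂ ∈ W then (1 : R) else 0)))
          - (∑ W ∈ U.powerset, prob pr (coreLevel arcs s U W) *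
            chainMix ent ent' 0 (chainC pr arcs s t U ent' a' a) (chainD pr arcs s t U ent' a' a) W) *
            (∑ W ∈ U.powerset, prob pr (coreLevel arcs s U W) *
            chainMix ent ent' 0 (chainC pr arcs s t U ent' a' a) (chainD pr arcs s t U ent' a' a) W *
            (if m₂ ∈ W then (1 : R) else 0)) *
            (∑ W ∈ U.powerset, prob pr (coreLevel arcs s U W) *
            chainMix ent ent' 1 (chainC pr arcs s t U ent' a' a) (chainD' pr arcs s t U ent' a' a w) W *
            (if m₁ ∈ W then (1 : R) else 0))
          - (∑ W ∈ U.powerset, prob pr (coreLevel arcs s U W) *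
            chainMix ent ent' 0 (chainC pr arcs s t U ent' a' a) (chainD pr arcs s t U ent' a' a) W) *
            (∑ W ∈ U.powerset, prob pr (coreLevel arcs s U W) *
            chainMix ent ent' 0 (chainC pr arcs s t U ent' a' a) (chainD pr arcs s t U ent' a' a) W *
            (if m₁ ∈ W then (1 : R) else 0)) *
            (∑ W ∈ U.powerset, prob pr (coreLevel arcs s U W) *
            chainMix ent ent' 1 (chainC pr arcs s t U ent' a' a) (chainD' pr arcs s t U ent' a' a w) W *
            (if m₂ ∈ W then (1 : R) else 0))
          + (∑ W ∈ U.powerset, prob pr (coreLevel arcs s U W) *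
            chainMix ent ent' 0 (chainC pr arcs s t U ent' a' a) (chainD pr arcs s t U ent' a' a) W *
            (if m₁ ∈ W then (1 : R) else 0)) *
            (∑ W ∈ U.powerset, prob pr (coreLevel arcs s U W) *
            chainMix ent ent' 0 (chainC pr arcs s t U ent' a' a) (chainD pr arcs s t U ent' a' a) W *
            (if m₂ ∈ W then (1 : R) else 0)) *
            (∑ W ∈ U.powerset, prob pr (coreLevel arcs s U W) *
            chainMix ent ent' 1 (chainC pr arcs s t U ent' a' a) (chainD' pr arcs s t U ent' a' a w) W))
        - (∑ W ∈ U.powerset, prob pr (coreLevel arcs s U W) *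
            chainMix ent ent' 0 (chainC pr arcs s t U ent' a' a) (chainD' pr arcs s t U ent' a' a w) W) *
          (((∑ W ∈ U.powerset, prob pr (coreLevel arcs s U W) *
            chainMix ent ent' 1 (chainC pr arcs s t U ent' a' a) (chainD pr arcs s t U ent' a' a) W) *
              (∑ W ∈ U.powerset, prob pr (coreLevel arcs s U W) *
            chainMix ent ent' 0 (chainC pr arcs s t U ent' a' a) (chainD pr arcs s t U ent' a' a) W *
            (if m₁ ∈ W then (1 : R) else 0))
            - (∑ W ∈ U.powerset, prob pr (coreLevel arcs s U W) *
            chainMix ent ent' 0 (chainC pr arcs s t U ent' a' a) (chainD pr arcs s t U ent' a' a) W) *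
              (∑ W ∈ U.powerset, prob pr (coreLevel arcs s U W) *
            chainMix ent ent' 1 (chainC pr arcs s t U ent' a' a) (chainD pr arcs s t U ent' a' a) W *
            (if m₁ ∈ W then (1 : R) else 0))) *
           ((∑ W ∈ U.powerset, prob pr (coreLevel arcs s U W) *
            chainMix ent ent' 1 (chainC pr arcs s t U ent' a' a) (chainD pr arcs s t U ent' a' a) W) *
              (∑ W ∈ U.powerset, prob pr (coreLevel arcs s U W) *
            chainMix ent ent' 0 (chainC pr arcs s t U ent' a' a) (chainD pr arcs s t U ent' a' a) W *
            (if m₂ ∈ W then (1 : R) else 0))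
            - (∑ W ∈ U.powerset, prob pr (coreLevel arcs s U W) *
            chainMix ent ent' 0 (chainC pr arcs s t U ent' a' a) (chainD pr arcs s t U ent' a' a) W) *
              (∑ W ∈ U.powerset, prob pr (coreLevel arcs s U W) *
            chainMix ent ent' 1 (chainC pr arcs s t U ent' a' a) (chainD pr arcs s t U ent' a' a) W *
            (if m₂ ∈ W then (1 : R) else 0))))) :
    DARC pr arcs s {t} m₁ m₂ a w := by
  obtain ⟨hA0, hAmono, hAlsm⟩ := OrTailU.head_props (U := insert a' U) (a := a) pr hp hS t
  obtain ⟨hdc, hd'd, hcc, hdd, hd'd', hdd', hratio, hratio', -, hcd, hcd'⟩ :=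
    chainPhi_head_hyps (fun X => prob pr (coreAvoidEvent arcs s t (insert a (insert a' U)) X))
      ent' a' a w hA0 hAmono hAlsm
  have hx0 : ∀ W : Finset V, (0 : R) ≤ (if m₁ ∈ W then (1 : R) else 0) := by
    intro W; split_ifs <;> norm_num
  have hy0 : ∀ W : Finset V, (0 : R) ≤ (if m₂ ∈ W then (1 : R) else 0) := by
    intro W; split_ifs <;> norm_num
  have hxm : ∀ s t : Finset V,
      (if m₁ ∈ s then (1 : R) else 0) ≤ (if m₁ ∈ s ∪ t then (1 : R) else 0) := by
    intro s t
    by_cases h : m₁ ∈ s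
    · rw [if_pos h, if_pos (Finset.mem_union_left t h)]
    · rw [if_neg h]; split_ifs <;> norm_num
  have hym : ∀ s t : Finset V,
      (if m₂ ∈ s then (1 : R) else 0) ≤ (if m₂ ∈ s ∪ t then (1 : R) else 0) := by
    intro s t
    by_cases h : m₂ ∈ s
    · rw [if_pos h, if_pos (Finset.mem_union_left t h)]
    · rw [if_neg h]; split_ifs <;> norm_num
  refine chain_darc_of_functional pr hS h' hsure' h hsure hentU hm₁ hm₂ htC hts hws hwC ?_
  exact chain_functional_nonneg_of_XA U ent ent' (fun W => prob pr (coreLevel arcs s U W))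
    (chainC pr arcs s t U ent' a' a) (chainD pr arcs s t U ent' a' a) (chainD' pr arcs s t U ent' a' a w)
    (pr (c a')) (hp.nonneg _) (hp.le_one _) (fun W => prob_nonneg hp _)
    (fun s' hs' t' ht' => hν s' t' hs' ht') (fun W => hA0 _) (fun W => hA0 _) (fun W => hA0 _)
    hdc (fun W => le_trans (hd'd W) (hdc W)) hd'd hcc hdd hd'd' hcd hcd' hdd' hratio hratio'
    (fun W => if m₁ ∈ W then (1 : R) else 0) (fun W => if m₂ ∈ W then (1 : R) else 0)
    hx0 hy0 hxm hym hpos0 hpos1 hmI hXA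

end XADarc

end Summit.Ventures.PercRepro2.Coin
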